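import Literature.NumberTheory.ComplexMultiplication.CMTypeUniformizationDescendedMultiplications
import Literature.NumberTheory.ComplexMultiplication.CMTypeUniformizationBaseChange
import Literature.AlgebraicGeometry.Motives.AbelianVarietyIsogenyPairFlip
import Literature.AlgebraicGeometry.Motives.AbelianVarietyProjective
import HarnessLib

/-!
# The main theorem of complex multiplication, level `N`: the `𝔮`-multiplication `λ : A → A_i` over the level field
# (Shimura 1998, §18.6 p. 166 L5–12; piece D4 «S2-feeding» of the S7a assembly)

Topic `NumberTheory/ComplexMultiplication`; namespace `Literature.NumberTheory.ComplexMultiplication.CMTypeUniformization`.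
KERNEL ONLY: theorems; no definition, no named fact, no `sorry`.

In the proof of [Shimura1998, Thm. 18.6] (p. 166): `(A, ι)` is of type `(K, Φ; 𝔞)` with uniformisation `ξ`, `A_i` is the class
representative of type `(K, Φ; 𝔟ᵢ)`, `𝔟ᵢ = 𝔮⁻¹𝔞` (`𝔮` an integral ideal — the reflex type norm of the Frobenius prime), with
uniformisation `η`; «let `λ` be the `𝔮`-multiplication of `A` onto `A_i` … the identity map of `ℂⁿ` defines `λ`»:
`λ(ξ(q(u))) = η(q(u))` for all `u ∈ K`.  With all homomorphisms `A → A_i` rational over the level field `k = L₁`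
(hypothesis `hAB` = surjectivity of `Hom.baseChange ℂ`, piece G1 of the cell's S7a plan) this `λ` is a `k`-HOMOMORPHISM,
and an ISOGENY:

* `one_mem_inv_mul_of_coeIdeal_mul_eq` — `𝔮 𝔟 = 𝔞` with `𝔮` integral ⇒ `1 ∈ 𝔞⁻¹𝔟` (the `S(1)` of [Shimura1998, §7.4 Prop. 15]
  is available between types `𝔞 ⊆ 𝔟`);
* `exists_qMultiplication` — `∃ λ : A ⟶ B` over `k`, `𝔬_K`-equivariant, with `λ_ℂ(ξ.r u) = η.r u` (the base-change shape, by
  the tree's `exists_hom_baseChange_map_r_eq` at `c := 1`) AND `λ((ofBaseChange ξ).r u) = (ofBaseChange η).r u` — the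
  `k`-shape, i.e. LITERALLY the hypothesis `_hlam` of the named fact `shimuraTaniyamaPair` (F-S2) at `k`, `ξ := ofBaseChange ξ`,
  `η := ofBaseChange η` (its `_h𝔮𝔟` is the same `𝔮 𝔟 = 𝔞`);
* `qMultiplication_unique` — any two homomorphisms with the base-change relation coincide;
* **`isIsogeny_of_map_baseChange_r_eq`** — such a `λ` is an ISOGENY ([Shimura1998] p. 166 «a homomorphism `λ` of `A`
  onto `A_i`»; §7.1 Prop. 7: an `𝔞`-multiplication is an isogeny): with the homomorphisms `B → A` also rational over `k`
  (`hBA`) the `S(N𝔮)`-multiplication `μ : B → A` (`N𝔮 ∈ 𝔮 = 𝔟⁻¹𝔞`) satisfies `λ ≫ μ = ι(N𝔮) = N𝔮 • 𝟙`, so `λ` is an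
  isogeny (`isIsogeny_of_comp_eq_nsmul_id`; `dim A = dim B` from the two uniformisations); corollaries: composition with
  an isomorphism, dominance of the underlying scheme morphism and of every base change (the `[IsDominant …]` inputs of the
  PAIR piece for `κ = λ ≫ θ`).

Written for the cell `hodgecm-mathlib` (fan B, line `b2-main-theorem-cm`, S7a `levelStructure_of_facts`, piece D4 of the
harness of record; consumer: `S7aHarness.core`'s S2 call at `A := A₀ ⊗ L₁`, `B := Arep c`).  Nothing of [Shimura1998]
beyond these statements is asserted.

## References
* [Shimura1998] G. Shimura, *Abelian Varieties with Complex Multiplication and Modular Functions*, PUP (1998), §7.4 Prop. 15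
  p. 58; §18.6 proof of Thm. 18.6, p. 166 L5–12 (held chunk p0166).
-/

set_option autoImplicit false

noncomputable section

open CategoryTheory NumberField
open scoped NumberField nonZeroDivisors

namespace Literature.NumberTheory.ComplexMultiplication

open Literature.AlgebraicGeometry.Motives (CMType AbelianVariety AlgPoints)
open Literature.AlgebraicGeometry.Motives.AbelianVariety

namespace CMTypeUniformization

variable {K : Type} [Field K] [NumberField K]

/-- **`𝔮 𝔟 = 𝔞` with `𝔮 ⊆ 𝔬_K` gives `1 ∈ 𝔞⁻¹𝔟`** (`𝔞 = 𝔮𝔟 ≤ 𝔟`, so `1 ∈ 𝔞⁻¹𝔞 ≤ 𝔞⁻¹𝔟`): the identity of `ℂⁿ` is an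
`S(1)`-homomorphism from type `𝔞` to type `𝔟 = 𝔮⁻¹𝔞`. [cite: Shimura1998, §7.4 Prop. 15, p. 58; §18.6 p. 166 L9] -/
theorem one_mem_inv_mul_of_coeIdeal_mul_eq (𝔞 𝔟 : (FractionalIdeal (𝓞 K)⁰ K)ˣ) (𝔮 : Ideal (𝓞 K))
    (h𝔮𝔟 : (𝔮 : FractionalIdeal (𝓞 K)⁰ K) * (𝔟 : FractionalIdeal (𝓞 K)⁰ K) = 𝔞) :
    (1 : K) ∈ ((𝔞 : FractionalIdeal (𝓞 K)⁰ K)⁻¹ * 𝔟 : FractionalIdeal (𝓞 K)⁰ K) := by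
  have h𝔞0 : (𝔞 : FractionalIdeal (𝓞 K)⁰ K) ≠ 0 := 𝔞.ne_zero
  have hle : (𝔞 : FractionalIdeal (𝓞 K)⁰ K) ≤ 𝔟 := by
    rw [← h𝔮𝔟]
    calc (𝔮 : FractionalIdeal (𝓞 K)⁰ K) * 𝔟 ≤ 1 * 𝔟 := mul_le_mul_left FractionalIdeal.coeIdeal_le_one _
      _ = 𝔟 := one_mul _
  have h1 : (1 : FractionalIdeal (𝓞 K)⁰ K) ≤ (𝔞 : FractionalIdeal (𝓞 K)⁰ K)⁻¹ * 𝔟 := by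
    calc (1 : FractionalIdeal (𝓞 K)⁰ K) = (𝔞 : FractionalIdeal (𝓞 K)⁰ K)⁻¹ * 𝔞 := (inv_mul_cancel₀ h𝔞0).symm
      _ ≤ (𝔞 : FractionalIdeal (𝓞 K)⁰ K)⁻¹ * 𝔟 := mul_le_mul_right hle _
  exact h1 (FractionalIdeal.one_mem_one _)

variable {Φ : CMType K} {𝔞 𝔟 : (FractionalIdeal (𝓞 K)⁰ K)ˣ}
  {k : Type} [Field k] [Algebra k ℂ] {A B : AbelianVariety k} {ιA : 𝓞 K →+* End A} {ιB : 𝓞 K →+* End B}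

/-- **The `𝔮`-multiplication `λ : A → A_i` over the level field** ([Shimura1998] p. 166: «the identity map of `ℂⁿ`
defines a homomorphism `λ` of `A` onto `A_i` … `λ(ξ(q(u))) = η(q(u))`»): for base-change uniformisations `ξ` of
`(A ⊗ ℂ, ιA ⊗ ℂ)` of type `𝔞` and `η` of `(B ⊗ ℂ, ιB ⊗ ℂ)` of type `𝔟` with `𝔮 𝔟 = 𝔞`, and every `ℂ`-homomorphism
`A ⊗ ℂ → B ⊗ ℂ` rational over `k` (`hAB`), there is a `k`-homomorphism `λ : A ⟶ B`, `𝔬_K`-equivariant, with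
`λ_ℂ(ξ.r u) = η.r u` and — read on `k`-models through `ofBaseChange` — `λ((ofBaseChange ξ).r u) = (ofBaseChange η).r u`,
the hypothesis `_hlam` of `shimuraTaniyamaPair`. [cite: Shimura1998, §18.6 proof of Thm. 18.6, p. 166 L5–12; §7.4 Prop. 15 p. 58] -/
theorem exists_qMultiplication
    (ξ : CMTypeUniformization Φ 𝔞 (A.baseChange ℂ) ((endBaseChange ℂ A).comp ιA))
    (η : CMTypeUniformization Φ 𝔟 (B.baseChange ℂ) ((endBaseChange ℂ B).comp ιB))
    (hAB : Function.Surjective (Hom.baseChange ℂ : (A ⟶ B) → (A.baseChange ℂ ⟶ B.baseChange ℂ)))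
    (𝔮 : Ideal (𝓞 K)) (h𝔮𝔟 : (𝔮 : FractionalIdeal (𝓞 K)⁰ K) * (𝔟 : FractionalIdeal (𝓞 K)⁰ K) = 𝔞) :
    ∃ lam : A ⟶ B, (∀ a : 𝓞 K, (ιA a : A ⟶ A) ≫ lam = lam ≫ (ιB a : B ⟶ B)) ∧
      (∀ u : K, AlgPoints.map (Hom.baseChange ℂ lam).hom.hom.hom (ξ.r u) = η.r u) ∧
      (∀ u : K, AlgPoints.map lam.hom.hom.hom ((ofBaseChange ξ).r u) = (ofBaseChange η).r u) := by
  obtain ⟨lam, hι, hlam⟩ := exists_hom_baseChange_map_r_eq ξ η hAB (one_mem_inv_mul_of_coeIdeal_mul_eq 𝔞 𝔟 𝔮 h𝔮𝔟)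
  have hlam' : ∀ u : K, AlgPoints.map (Hom.baseChange ℂ lam).hom.hom.hom (ξ.r u) = η.r u := fun u => by
    rw [hlam u, one_mul]
  exact ⟨lam, hι, hlam', fun u => ofBaseChange_r_of_map_baseChange_r_eq ξ η lam u (hlam' u)⟩

/-- **`λ` is unique**: two `k`-homomorphisms `A ⟶ B` with `λ_ℂ(ξ.r u) = η.r u` for all `u ∈ K` coincide (the `ξ.r u`
exhaust the torsion of `A(ℂ)`; base change of homomorphisms is injective). [cite: Shimura1998, §7.4 Prop. 15 and proof of Prop. 17, p. 58] -/
theorem qMultiplication_unique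
    (ξ : CMTypeUniformization Φ 𝔞 (A.baseChange ℂ) ((endBaseChange ℂ A).comp ιA))
    (η : CMTypeUniformization Φ 𝔟 (B.baseChange ℂ) ((endBaseChange ℂ B).comp ιB)) {lam lam' : A ⟶ B}
    (hlam : ∀ u : K, AlgPoints.map (Hom.baseChange ℂ lam).hom.hom.hom (ξ.r u) = η.r u)
    (hlam' : ∀ u : K, AlgPoints.map (Hom.baseChange ℂ lam').hom.hom.hom (ξ.r u) = η.r u) : lam = lam' :=
  hom_eq_of_forall_baseChange_map_r_eq ξ fun u => by rw [hlam, hlam']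

/-! ## `λ` is an isogeny -/

omit [NumberField K] in
/-- `𝔮 𝔟 = 𝔞` gives `N𝔮 ∈ 𝔟⁻¹𝔞` (`𝔟⁻¹𝔞 = 𝔮 ∋ N𝔮`, `Ideal.absNorm_mem`): the integer `N𝔮` is an `S(N𝔮)` from type `𝔟` to
type `𝔞`. [cite: Shimura1998, §7.4 Prop. 15, p. 58] -/
theorem natCast_absNorm_mem_inv_mul [NumberField K] (𝔞 𝔟 : (FractionalIdeal (𝓞 K)⁰ K)ˣ) (𝔮 : Ideal (𝓞 K))
    (h𝔮𝔟 : (𝔮 : FractionalIdeal (𝓞 K)⁰ K) * (𝔟 : FractionalIdeal (𝓞 K)⁰ K) = 𝔞) :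
    ((Ideal.absNorm 𝔮 : ℕ) : K) ∈ ((𝔟 : FractionalIdeal (𝓞 K)⁰ K)⁻¹ * 𝔞 : FractionalIdeal (𝓞 K)⁰ K) := by
  have h𝔟0 : (𝔟 : FractionalIdeal (𝓞 K)⁰ K) ≠ 0 := 𝔟.ne_zero
  have heq : ((𝔟 : FractionalIdeal (𝓞 K)⁰ K)⁻¹ * 𝔞 : FractionalIdeal (𝓞 K)⁰ K) = 𝔮 := by
    rw [← h𝔮𝔟, mul_comm (𝔮 : FractionalIdeal (𝓞 K)⁰ K), ← mul_assoc, inv_mul_cancel₀ h𝔟0, one_mul]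
  rw [heq, FractionalIdeal.mem_coeIdeal]
  exact ⟨(Ideal.absNorm 𝔮 : 𝓞 K), Ideal.absNorm_mem 𝔮, by simp⟩

/-- **two base-change uniformised `k`-models have the same dimension** (`dim A = #Φ = dim B`). [cite: Shimura1998, §18.4 p. 126] -/
theorem dim_eq_of_uniformizations
    (ξ : CMTypeUniformization Φ 𝔞 (A.baseChange ℂ) ((endBaseChange ℂ A).comp ιA))
    (η : CMTypeUniformization Φ 𝔟 (B.baseChange ℂ) ((endBaseChange ℂ B).comp ιB)) : A.dim = B.dim := by
  have hA : Module.finrank ℂ (Φ.1 → ℂ) = A.dim := by simpa only [dim_baseChange] using ξ.finrank_eq_dim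
  have hB : Module.finrank ℂ (Φ.1 → ℂ) = B.dim := by simpa only [dim_baseChange] using η.finrank_eq_dim
  exact hA.symm.trans hB

/-- **the relation `λ ≫ μ = N𝔮 • 𝟙`**: if `λ_ℂ(ξ.r u) = η.r u` and `μ_ℂ(η.r u) = ξ.r (N𝔮 · u)` then `λ ≫ μ` is the
multiplication by the integer `N𝔮` (both induce `S(N𝔮)` on `ξ`; uniqueness of the inducing `k`-homomorphism, and
`ι(N𝔮) = N𝔮 • 𝟙`). [cite: Shimura1998, §7.1 Prop. 9, p. 51; §7.4 Prop. 15, p. 58] -/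
theorem comp_eq_nsmul_of_map_baseChange_r_eq
    (ξ : CMTypeUniformization Φ 𝔞 (A.baseChange ℂ) ((endBaseChange ℂ A).comp ιA))
    (η : CMTypeUniformization Φ 𝔟 (B.baseChange ℂ) ((endBaseChange ℂ B).comp ιB)) {lam : A ⟶ B} {μ : B ⟶ A} {n : ℕ}
    (hlam : ∀ u : K, AlgPoints.map (Hom.baseChange ℂ lam).hom.hom.hom (ξ.r u) = η.r u)
    (hμ : ∀ u : K, AlgPoints.map (Hom.baseChange ℂ μ).hom.hom.hom (η.r u) = ξ.r ((n : K) * u)) :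
    lam ≫ μ = n • 𝟙 A := by
  have h1 : lam ≫ μ = (ιA (n : 𝓞 K) : A ⟶ A) := by
    refine hom_eq_of_forall_baseChange_map_r_eq ξ fun u => ?_
    rw [Hom.baseChange_comp, map_hom_comp, hlam, hμ, baseChange_map_r_eq_of_eq_ι]
    rfl
  rw [h1, map_natCast]
  exact (show ((n : ℕ) : End A) = n • (1 : End A) from (nsmul_one n).symm)

/-- **the `𝔮`-multiplication is an isogeny** ([Shimura1998] p. 166 «a homomorphism `λ` of `A` ONTO `A_i`»): for `λ : A ⟶ B`
over `k` with `λ_ℂ(ξ.r u) = η.r u` (types `𝔞`, `𝔟`, `𝔮 𝔟 = 𝔞`) and the `ℂ`-homomorphisms `B ⊗ ℂ → A ⊗ ℂ` rational over `k`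
(`hBA`), `λ` is an isogeny: `λ ≫ μ = N𝔮 • 𝟙` for the `k`-rational `S(N𝔮)`-multiplication `μ`, `N𝔮 ≠ 0`, `dim A = dim B`.
[cite: Shimura1998, §18.6 proof of Thm. 18.6, p. 166 L9; §7.1 Prop. 7, p. 50] [cite: MumfordAV1970, §19 Remark p. 169] -/
theorem isIsogeny_of_map_baseChange_r_eq
    (ξ : CMTypeUniformization Φ 𝔞 (A.baseChange ℂ) ((endBaseChange ℂ A).comp ιA))
    (η : CMTypeUniformization Φ 𝔟 (B.baseChange ℂ) ((endBaseChange ℂ B).comp ιB))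
    (hBA : Function.Surjective (Hom.baseChange ℂ : (B ⟶ A) → (B.baseChange ℂ ⟶ A.baseChange ℂ)))
    (𝔮 : Ideal (𝓞 K)) (h𝔮𝔟 : (𝔮 : FractionalIdeal (𝓞 K)⁰ K) * (𝔟 : FractionalIdeal (𝓞 K)⁰ K) = 𝔞)
    {lam : A ⟶ B} (hlam : ∀ u : K, AlgPoints.map (Hom.baseChange ℂ lam).hom.hom.hom (ξ.r u) = η.r u) :
    IsIsogeny lam := by
  haveI : CharZero k := (algebraMap k ℂ).charZero
  have h𝔮0 : 𝔮 ≠ ⊥ := by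
    rintro rfl
    exact 𝔞.ne_zero (by rw [← h𝔮𝔟, FractionalIdeal.coeIdeal_bot, zero_mul])
  have hn0 : ((Ideal.absNorm 𝔮 : ℕ) : k) ≠ 0 := Nat.cast_ne_zero.2 (Ideal.absNorm_eq_zero_iff.not.2 h𝔮0)
  obtain ⟨μ, -, hμ⟩ := exists_hom_baseChange_map_r_eq η ξ hBA (natCast_absNorm_mem_inv_mul 𝔞 𝔟 𝔮 h𝔮𝔟)
  exact isIsogeny_of_comp_eq_nsmul_id hn0 (comp_eq_nsmul_of_map_baseChange_r_eq ξ η hlam hμ)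
    (dim_eq_of_uniformizations ξ η)


end CMTypeUniformization

end Literature.NumberTheory.ComplexMultiplication

namespace Literature.AlgebraicGeometry.Motives.AbelianVariety

open _root_.AlgebraicGeometry _root_.CategoryTheory

section Dominance

variable {k : Type} [Field k] {A B : AbelianVariety k}

/-! ## Corollaries: `κ = λ ≫ θ` and its base changes are dominant -/

/-- an isogeny followed by an isomorphism is an isogeny. [cite: MumfordAV1970, §19 Remark p. 169] -/
theorem isIsogeny_comp_iso_hom {C : AbelianVariety k}
    {lam : A ⟶ B} (hlam : IsIsogeny lam) (θ : B ≅ C) : IsIsogeny (lam ≫ θ.hom) := by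
  refine isIsogeny_comp hlam ⟨?_, ?_⟩
  · exact ⟨fun y => ⟨Hom.toSchemeHom θ.inv y, by
      rw [← Scheme.Hom.comp_apply]
      change Hom.toSchemeHom (θ.inv ≫ θ.hom) y = y
      rw [θ.inv_hom_id]
      rfl⟩⟩
  · haveI : IsIso (Hom.toSchemeHom θ.hom) :=
      ⟨⟨Hom.toSchemeHom θ.inv, by rw [← toSchemeHom_comp, θ.hom_inv_id]; rfl,
        by rw [← toSchemeHom_comp, θ.inv_hom_id]; rfl⟩⟩
    infer_instance

/-- an isogeny has dominant underlying scheme morphism (it is surjective). [cite: MumfordAV1970, §7 Application 3 (p. 63)] -/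
theorem IsIsogeny.isDominant_toSchemeHom {lam : A ⟶ B}
    (hlam : IsIsogeny lam) : IsDominant (Hom.toSchemeHom lam) := by
  haveI := hlam.1
  infer_instance

/-- … and so has every base change of it (isogenies are stable under base change). [cite: GortzWedhorn2020, Prop. 4.32 (2)] [cite: MumfordAV1970, §7 Application 3 (p. 63)] -/
theorem IsIsogeny.isDominant_toSchemeHom_baseChange
    (L' : Type) [Field L'] [Algebra k L'] {lam : A ⟶ B} (hlam : IsIsogeny lam) :
    IsDominant (Hom.toSchemeHom (Hom.baseChange L' lam)) :=
  (hlam.baseChange L').isDominant_toSchemeHom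

end Dominance

end Literature.AlgebraicGeometry.Motives.AbelianVariety

end
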